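import Summits.FinalStateConjecture.FinalStateConjecture.Theorems.PhotonSphereChannelsDarkFutureDefs
import Literature.Geometry.Lorentzian.Isometry
import HarnessLib

/-!
# Route PhotonSphereChannels · crux `ChannelsResolveTameDevelopmentsR` · line `dark-future-exactness`
# Glue T1 (wave 3): transfer of `IsKerrDoc` along an injective orientation-preserving local isometry

If `j : 𝓢 → 𝓢'` is an injective local isometry of spacetimes whose differential maps
future-directed vectors to future-directed vectors, and `j '' O ⊆ 𝓢'` is a Kerr domain of outer
communications `(M, a)` in the sense of `TameHull.IsKerrDoc` (an injective `C^∞` chart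
`Ψ' : Kerr.exterior M a → 𝓢'` with image `j '' O`, vanishing Kerr–Schild deviation and
future-directed `Ψ'_* ∂_{t*}` on `{r > 2M}`), then so is `O ⊆ 𝓢`: the chart factors as
`Ψ' = j ∘ Ψ` with `Ψ := j⁻¹ ∘ Ψ'` (`range Ψ' ⊆ range j`), and

* `Ψ` is `C^∞`: `j` is an injective local homeomorphism, hence an open embedding, so `Ψ` is
  continuous; near every point `Ψ = j_loc⁻¹ ∘ Ψ'` for a local inverse `j_loc⁻¹` of the local
  diffeomorphism `j` (`IsLocalDiffeomorphAt.localInverse`), a composite of `C^∞` maps;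
* the deviations agree, `Ψ'^* g' = Ψ^* (j^* g') = Ψ^* g` (chain rule `pullbackBilin_comp` and the
  pullback identity `j^* g' = g` of `IsLocalIsometry`);
* `Ψ_* ∂_{t*}` is future-directed: `dj` is a fibrewise linear isometry, so `v := Ψ_* ∂_{t*}` is causal
  with `dj v = Ψ'_* ∂_{t*}` future-directed; were `v` past-directed, `-v` would be future-directed and
  so would be `dj (-v) = -(dj v)`, which is past-directed — a contradiction.

This is the TRANSFER clause of the reshaped producer P″ (Reshape 2 of the line skeleton): whenever
the producer's representative `𝓢'` contains an isometric copy `j(𝓢)` with `j '' E.doc = E'.doc`,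
the Kerr-d.o.c. property of `E'.doc` descends to `E.doc`.

References: B. O'Neill, *Semi-Riemannian geometry*, Academic Press 1983, Ch. 3, pp. 90–91 (local
isometries), Ch. 5, p. 145 (time orientation, future/past timecones); M. Dafermos, J. Luk,
arXiv:1710.01722 (2017), Conjecture 1 (the Kerr exterior as final state).
-/

noncomputable section

-- the operator-norm instance on `E4 →L[ℝ] E4 →L[ℝ] ℝ` needs one more level of pending
-- instance problems than the default (as in `TameHullDefs`)
set_option maxSynthPendingDepth 3
-- every `Summit.FinalStateConjecture.FinalStateConjecture.…` name repeats the summit segment (D-0017 layout)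
set_option linter.dupNamespace false

open Set Filter Function TopologicalSpace Manifold Bundle
open scoped Topology Manifold ContDiff ENNReal NNReal

namespace Summit.FinalStateConjecture.FinalStateConjecture.Theorems.DarkFuture

open Literature.Geometry.Lorentzian
open Summit.FinalStateConjecture.FinalStateConjecture.Theorems.TameHull

/-! ### Smoothness of a continuous lift through a local diffeomorphism -/

section LocalInverse

variable {E₁ : Type*} [NormedAddCommGroup E₁] [NormedSpace ℝ E₁] {H₁ : Type*} [TopologicalSpace H₁]
  {I₁ : ModelWithCorners ℝ E₁ H₁} {X : Type*} [TopologicalSpace X] [ChartedSpace H₁ X]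
  {E₂ : Type*} [NormedAddCommGroup E₂] [NormedSpace ℝ E₂] {H₂ : Type*} [TopologicalSpace H₂]
  {I₂ : ModelWithCorners ℝ E₂ H₂} {Y : Type*} [TopologicalSpace Y] [ChartedSpace H₂ Y]
  {E₃ : Type*} [NormedAddCommGroup E₃] [NormedSpace ℝ E₃] {H₃ : Type*} [TopologicalSpace H₃]
  {I₃ : ModelWithCorners ℝ E₃ H₃} {Z : Type*} [TopologicalSpace Z] [ChartedSpace H₃ Z]
  {n : ℕ∞ω}

/-- **Lifting smoothness through a local diffeomorphism.** If `j : Y → Z` is a `C^n` local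
diffeomorphism at `Ψ x`, `Ψ : X → Y` is continuous at `x` and `j ∘ Ψ` is `C^n` at `x`, then `Ψ` is
`C^n` at `x`: near `x`, `Ψ = j_loc⁻¹ ∘ (j ∘ Ψ)` for the local inverse `j_loc⁻¹` of `j` around `Ψ x`
(`IsLocalDiffeomorphAt.localInverse`, `C^n` at `j (Ψ x)`), the neighbourhood being
`Ψ⁻¹ (target of j_loc⁻¹)` (this is where continuity of `Ψ` is used). O'Neill 1983, Ch. 1,
pp. 20–21 (inverse function theorem on manifolds). [folklore] -/
theorem contMDiffAt_of_comp_isLocalDiffeomorphAt {j : Y → Z} {Ψ : X → Y} {x : X}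
    (hj : IsLocalDiffeomorphAt I₂ I₃ n j (Ψ x)) (hΨ : ContinuousAt Ψ x)
    (hjΨ : ContMDiffAt I₁ I₃ n (j ∘ Ψ) x) : ContMDiffAt I₁ I₂ n Ψ x := by
  have hev : hj.localInverse ∘ (j ∘ Ψ) =ᶠ[𝓝 x] Ψ := by
    filter_upwards [hΨ.preimage_mem_nhds
      (hj.localInverse.open_target.mem_nhds hj.localInverse_mem_target)] with x' hx'
    exact hj.localInverse_left_inv hx'
  exact (hj.localInverse_contMDiffAt.comp x hjΨ).congr_of_eventuallyEq hev.symm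

/-- **Lifting smoothness through an injective local diffeomorphism.** If `j : Y → Z` is an
injective `C^n` local diffeomorphism and `j ∘ Ψ` is `C^n`, then `Ψ : X → Y` is `C^n`. Continuity of
`Ψ` comes first: an injective local homeomorphism is an open embedding (Mathlib
`IsLocalHomeomorph.isOpenEmbedding_of_injective`), and continuity into the domain of an embedding
is tested after composition (`Topology.IsEmbedding.continuous_iff`); then
`contMDiffAt_of_comp_isLocalDiffeomorphAt` applies at every point. O'Neill 1983, Ch. 1,
pp. 20–21. [folklore] -/
theorem contMDiff_of_comp_isLocalDiffeomorph {j : Y → Z} {Ψ : X → Y}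
    (hj : IsLocalDiffeomorph I₂ I₃ n j) (hinj : Function.Injective j)
    (hjΨ : ContMDiff I₁ I₃ n (j ∘ Ψ)) : ContMDiff I₁ I₂ n Ψ := by
  have hcont : Continuous Ψ :=
    (hj.isLocalHomeomorph.isOpenEmbedding_of_injective hinj).isEmbedding.continuous_iff.mpr
      hjΨ.continuous
  exact fun x ↦ contMDiffAt_of_comp_isLocalDiffeomorphAt (hj (Ψ x)) hcont.continuousAt (hjΨ x)

end LocalInverse

/-! ### Local isometries: pullbacks and time orientation -/

/-- **Functoriality of the metric deviation under a local isometry.** If `j : 𝓢 → 𝓢'` is a local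
isometry (`j^* g' = g`) and `Ψ : U → 𝓢` is differentiable, then the pullbacks of `g'` along `j ∘ Ψ`
and of `g` along `Ψ` agree, `(j ∘ Ψ)^* g' = Ψ^* (j^* g') = Ψ^* g` (chain rule `pullbackBilin_comp`);
hence the deviations from any reference background `B` on `U` agree. O'Neill 1983, Ch. 3, p. 58
(functoriality of pullback) and pp. 90–91 (local isometries). [cite: ONeill1983, Ch. 3, pp. 90–91] -/
theorem deviation_comp_of_isLocalIsometry {𝓢 𝓢' : Spacetime.{0} 4} (B : ModelBackground)
    {j : 𝓢.carrier → 𝓢'.carrier}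
    (hiso : PseudoRiemannianMetric.IsLocalIsometry 𝓢.metric.toPseudoRiemannianMetric
      𝓢'.metric.toPseudoRiemannianMetric j)
    {Ψ : B.domain → 𝓢.carrier} (hΨ : MDifferentiable 𝓘(ℝ, E4) (𝓡 4) Ψ) (x : B.domain) :
    𝓢'.deviation B (j ∘ Ψ) x = 𝓢.deviation B Ψ x := by
  have hpb : pullbackBilin (I := 𝓡 4) (I' := 𝓘(ℝ, E4)) (j ∘ Ψ) 𝓢'.metric.val =
      pullbackBilin (I := 𝓡 4) (I' := 𝓘(ℝ, E4)) Ψ 𝓢.metric.val := by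
    rw [pullbackBilin_comp (hiso.1.mdifferentiable (by simp)) hΨ]
    exact congrArg (pullbackBilin (I := 𝓡 4) (I' := 𝓘(ℝ, E4)) Ψ) (funext hiso.2)
  rw [Spacetime.deviation, Spacetime.deviation]
  exact congrArg (fun b : E4 →L[ℝ] E4 →L[ℝ] ℝ ↦ b - B.bilin x.1) (congrFun hpb x)

/-- **Future-directedness pulls back along an orientation-preserving local isometry.** Let
`j : 𝓢 → 𝓢'` be a local isometry whose differential maps future-directed vectors to future-directed
vectors, and let `v ∈ T_y 𝓢` with `dj v` future-directed in `𝓢'`. Then `v` is future-directed: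
`g(v, v) = g'(dj v, dj v) ≤ 0` and `v ≠ 0` (as `dj v ≠ 0`), so `v` is causal, hence future- or
past-directed (O'Neill 1983, Ch. 5, Lemma 5.26 ff.); if it were past-directed, `-v` would be
future-directed, so `dj (-v) = -(dj v)` would be future-directed, i.e. `dj v` past-directed —
impossible for a future-directed vector. O'Neill 1983, Ch. 5, p. 145. [cite: ONeill1983, Ch. 5, p. 145] -/
theorem isFutureDirected_of_mfderiv_of_isLocalIsometry {𝓢 𝓢' : Spacetime.{0} 4}
    {j : 𝓢.carrier → 𝓢'.carrier}
    (hiso : PseudoRiemannianMetric.IsLocalIsometry 𝓢.metric.toPseudoRiemannianMetric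
      𝓢'.metric.toPseudoRiemannianMetric j)
    (hfut : ∀ (x : 𝓢.carrier) (v : TangentSpace (𝓡 4) x), 𝓢.timeOrientation.IsFutureDirected v →
      𝓢'.timeOrientation.IsFutureDirected (mfderiv (𝓡 4) (𝓡 4) j x v))
    {y : 𝓢.carrier} {v : TangentSpace (𝓡 4) y}
    (hv : 𝓢'.timeOrientation.IsFutureDirected (mfderiv (𝓡 4) (𝓡 4) j y v)) :
    𝓢.timeOrientation.IsFutureDirected v := by
  have hvv : 𝓢'.metric.val (j y) (mfderiv (𝓡 4) (𝓡 4) j y v) (mfderiv (𝓡 4) (𝓡 4) j y v) =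
      𝓢.metric.val y v v := by
    have h := congrArg (fun b ↦ b v v) (hiso.2 y)
    simpa only [pullbackBilin_apply] using h
  have hcausal : 𝓢.metric.IsCausal v :=
    ⟨hvv ▸ hv.1.1, fun h0 ↦ hv.1.2 (by rw [h0, map_zero])⟩
  rcases 𝓢.timeOrientation.isFutureDirected_or_isPastDirected_of_isCausal hcausal with h | h
  · exact h
  · have hneg := hfut y (-v) ((𝓢.timeOrientation.isFutureDirected_neg_iff v).mpr h)
    rw [map_neg, TimeOrientation.isFutureDirected_neg_iff] at hneg
    exact absurd hneg (𝓢'.timeOrientation.not_isPastDirected_of_isFutureDirected hv)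

/-! ### The transfer theorem -/

/-- **Glue T1 (line `dark-future-exactness`, transfer clause of the reshaped producer P″).**
`TameHull.IsKerrDoc` descends along an injective local isometry `j : 𝓢 → 𝓢'` whose differential
preserves future-directedness: if `j '' O` is a Kerr domain of outer communications `(M, a)` of
`𝓢'`, then `O` is one of `𝓢`. The chart `Ψ'` of `j '' O` factors as `j ∘ Ψ` (`range Ψ' ⊆ range j`);
`Ψ` is injective with image `O` (`j` injective), `C^∞` (`contMDiff_of_comp_isLocalDiffeomorph`:
`j` is an open embedding and a local diffeomorphism), has the same — vanishing — Kerr–Schild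
deviation (`deviation_comp_of_isLocalIsometry`), and `Ψ_* ∂_{t*}` is future-directed on `{r > 2M}`
because `dj (Ψ_* ∂_{t*}) = Ψ'_* ∂_{t*}` is (`isFutureDirected_of_mfderiv_of_isLocalIsometry`).
O'Neill 1983, Ch. 3, pp. 90–91 and Ch. 5, p. 145; Dafermos–Luk 2017, Conjecture 1. [cite: ONeill1983, Ch. 3, pp. 90–91] -/
theorem isKerrDoc_of_isLocalIsometry_image : ∀ {𝓢 𝓢' : Spacetime.{0} 4} (j : 𝓢.carrier → 𝓢'.carrier) (O : Set 𝓢.carrier) (M a : ℝ), Function.Injective j → PseudoRiemannianMetric.IsLocalIsometry 𝓢.metric.toPseudoRiemannianMetric 𝓢'.metric.toPseudoRiemannianMetric j → (∀ (x : 𝓢.carrier) (v : TangentSpace (𝓡 4) x), 𝓢.timeOrientation.IsFutureDirected v → 𝓢'.timeOrientation.IsFutureDirected (mfderiv (𝓡 4) (𝓡 4) j x v)) → IsKerrDoc 𝓢' (j '' O) M a → IsKerrDoc 𝓢 O M a := by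
  intro 𝓢 𝓢' j O M a hj hiso hfut hdoc
  obtain ⟨Ψ', hΨ'inj, hΨ'smooth, hΨ'range, hΨ'dev, hΨ'fut⟩ := hdoc
  -- the chart of `j '' O` takes values in `range j`: factor it through `j`
  have hmem : ∀ x, Ψ' x ∈ Set.range j := fun x ↦ by
    obtain ⟨y, -, hy⟩ : Ψ' x ∈ j '' O := hΨ'range ▸ Set.mem_range_self x
    exact ⟨y, hy⟩
  choose Ψ hΨ using hmem
  obtain rfl : Ψ' = j ∘ Ψ := funext fun x ↦ (hΨ x).symm
  have hsmooth : ContMDiff 𝓘(ℝ, E4) (𝓡 4) ∞ Ψ :=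
    contMDiff_of_comp_isLocalDiffeomorph hiso.1 hj hΨ'smooth
  have hmd : MDifferentiable 𝓘(ℝ, E4) (𝓡 4) Ψ := hsmooth.mdifferentiable (by simp)
  refine ⟨Ψ, hΨ'inj.of_comp, hsmooth, ?_, fun x ↦ ?_, fun x hx ↦ ?_⟩
  · -- `j '' range Ψ = range (j ∘ Ψ) = j '' O` and `j` is injective
    exact hj.image_injective ((Set.range_comp j Ψ).symm.trans hΨ'range)
  · rw [← deviation_comp_of_isLocalIsometry (Kerr.background M a) hiso hmd x]
    exact hΨ'dev x
  · have h := hΨ'fut x hx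
    rw [mfderiv_comp x (hiso.1.mdifferentiable (by simp) (Ψ x)) (hmd x)] at h
    exact isFutureDirected_of_mfderiv_of_isLocalIsometry hiso hfut h

end Summit.FinalStateConjecture.FinalStateConjecture.Theorems.DarkFuture

end
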